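import Summits.AtomisticToContinuum.FouriersLaw.Theorems.PhononMeanFreePathIncoherentChannelLeftSensitivityTail
import Summits.AtomisticToContinuum.FouriersLaw.Theorems.PhononMeanFreePathIncoherentChannelCommonPastBudget

/-!
# `IncoherentChannel`, line `two-horizons-forecast-loss` — tail `L²(dt)` budget of the common-past term

Helper file for the lead's stub `stub_forecastLoss` (the ENGINE) of crux `PhononMeanFreePath.IncoherentChannel`
(item stmt-AtomisticToContinuum-11811, route `PhononMeanFreePath`, sub-problem `FouriersLaw`), vocabulary of
`PhononMeanFreePathDefs`: `S_N = fnorm` (forecast norm of the far bath momentum), `P_N = commonPast`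
(`Cov_{μ₀}(p_0², v_t²)`, the common-past part of the crux kernel), `D_N(s) = ∫ (v_s(z) − v_s(z̃))² d(μ₀ ⊗ N(0,T))`
(left sensitivity of the far forecast; `z̃` = `z` with the near-bath momentum resampled).

From the landed TAIL budget of the left sensitivity (`leftSensitivity_tail_budget`, p147650:
`∫⁻_{(0,t]} D_N(t₁ + s) ds ≤ π²/(8γ) · S_N(t₁)`) and the light-cone reduction `|P_N| ≤ K √D_N` (`lightCone_reduction`,
p92940 chain), the abstract transfer `commonPastBudget_of_pointwise` (p141111) gives the common-past term's `L²(dt)`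
TAIL slaved to the forecast norm at the start of the tail:

  `∫₀^∞ P_N(t₁ + s)² ds ≤ K² π²/(8γ) · S_N(t₁)`   for every `N` and every `t₁ ≥ 0`

(`commonPast_sq_tail_le`, registered; at `t₁ = 0` it is the landed `N`-uniform budget `commonPast_sq_integral_le`,
since `S_N(0) = T`). So after time `t₁` EVERY cross quantity of the line — coherent channel `r_N`, echo `a_N`
(`forecastBudget_tail`, p148747), left sensitivity `D_N`, common past `P_N` — has total remaining `L²(dt)`-mass at most a
fixed multiple of `S_N(t₁)`: the engine's one number `S_N(t₁)` budgets everything downstream. No definitions; nothing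
here closes an item.
-/

noncomputable section

namespace Summit.AtomisticToContinuum.FouriersLaw.Theorems.PhononMeanFreePath

open MeasureTheory Set Filter Topology ProbabilityTheory
open scoped NNReal ENNReal
open Literature.MathematicalPhysics.KineticTheory.HeatConduction

/-- **Tail `L²(dt)` budget of the common-past term (registered stub `commonPast_sq_tail_le`).** At every admissible
parameter point there is an `N`-INDEPENDENT `C ≥ 0` (namely `K(T)² · π²/(8γ)`, `K(T)` the constant of
`lightCone_reduction`) such that for every `N` and every start time `t₁ ≥ 0` the map `s ↦ P_N(t₁ + s)²` is integrable
on `(0,∞)` and `∫₀^∞ P_N(t₁ + s)² ds ≤ C · S_N(t₁)`. Proof: `|P_N(t₁+s)| ≤ K √(D_N(t₁+s))` pointwise, the tail budget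
`leftSensitivity_tail_budget` for `D_N`, and `commonPastBudget_of_pointwise`. [folklore] -/
theorem commonPast_sq_tail_le : ∀ ω₂ lam β γ : ℝ, 0 < ω₂ → 0 < lam → 0 < β → 0 < γ → ∀ T : ℝ, 0 < T → ∃ C : ℝ, 0 ≤ C ∧ ∀ (N : ℕ) (t₁ : ℝ), 0 ≤ t₁ → IntegrableOn (fun s => (commonPast ω₂ lam β γ T N (t₁ + s)) ^ 2) (Ioi (0 : ℝ)) ∧ ∫ s in Ioi (0 : ℝ), (commonPast ω₂ lam β γ T N (t₁ + s)) ^ 2 ≤ C * fnorm ω₂ lam β γ T N t₁ := by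
  intro ω₂ lam β γ hω hl hβ hγ T hT
  -- the `N`-independent constant of the light-cone reduction, obtained ONCE
  obtain ⟨K, -, hK⟩ := lightCone_reduction ω₂ lam β γ hω hl.le hβ.le hγ.le T hT
  refine ⟨K ^ 2 * (Real.pi ^ 2 / (8 * γ)), by positivity, fun N t₁ ht₁ => ?_⟩
  have hPm : Measurable fun s : ℝ => commonPast ω₂ lam β γ T N (t₁ + s) :=
    ((stub_commonPastBound ω₂ lam β γ hω hl hβ hγ T hT).1 N).1.comp (measurable_const.add measurable_id)
  have hB : 0 ≤ Real.pi ^ 2 / (8 * γ) * fnorm ω₂ lam β γ T N t₁ :=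
    mul_nonneg (by positivity) (fnorm_nonneg ω₂ lam β γ T N t₁)
  have h := commonPastBudget_of_pointwise (P := fun s => commonPast ω₂ lam β γ T N (t₁ + s))
    (D := fun s => ∫ x : PhaseSpace (N + 1) × ℝ, (fcast ω₂ lam β γ T N (t₁ + s) x.1 -
      fcast ω₂ lam β γ T N (t₁ + s) ((x.1.1, Function.update x.1.2 0 x.2) : PhaseSpace (N + 1))) ^ 2
      ∂(((pinnedChain ω₂ lam β γ).gibbsMeasure (N + 1) T).prod (gaussianReal 0 T.toNNReal)))
    hPm hB (fun s => (hK N (t₁ + s)).2) (fun s => integral_nonneg fun x => sq_nonneg _)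
    (fun t ht => leftSensitivity_tail_budget ω₂ lam β γ hω hl.le hβ hγ T hT N t₁ t ht₁ ht)
  refine ⟨h.1, h.2.trans (le_of_eq ?_)⟩
  ring

/-- **The same at `t₁ = 0` recovers the landed `N`-uniform budget** (`commonPast_sq_integral_le`, p141111 + assembly)
with the explicit constant: `∫₀^∞ P_N² ≤ C · T` for every `N` (`S_N(0) ≤ T`). [folklore] -/
theorem commonPast_sq_integral_le_explicit {ω₂ lam β γ T : ℝ} (hω : 0 < ω₂) (hl : 0 < lam) (hβ : 0 < β) (hγ : 0 < γ)
    (hT : 0 < T) : ∃ C : ℝ, 0 ≤ C ∧ ∀ N : ℕ, IntegrableOn (fun s => (commonPast ω₂ lam β γ T N s) ^ 2) (Ioi (0 : ℝ)) ∧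
      ∫ s in Ioi (0 : ℝ), (commonPast ω₂ lam β γ T N s) ^ 2 ≤ C * T := by
  obtain ⟨C, hC0, hC⟩ := commonPast_sq_tail_le ω₂ lam β γ hω hl hβ hγ T hT
  refine ⟨C, hC0, fun N => ?_⟩
  obtain ⟨hint, hle⟩ := hC N 0 le_rfl
  simp only [zero_add] at hint hle
  have hS0 : fnorm ω₂ lam β γ T N 0 ≤ T :=
    ((commonPastBound_forecastDictionary ω₂ lam β γ hω hl.le hβ.le hγ.le T hT N).2.2.2.2 0).2.1
  exact ⟨hint, hle.trans (mul_le_mul_of_nonneg_left hS0 hC0)⟩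

end Summit.AtomisticToContinuum.FouriersLaw.Theorems.PhononMeanFreePath

end
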